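import Summits.Langlands.Langlands.Theses.AbelianSurfaceSerre
import Summits.Langlands.Langlands.Theorems.PhantomRMYoshidaStableYoshidaCongruenceTateModuleIrreducible
import Literature.NumberTheory.DiophantineGeometry.BcgpSerreRegularWeightAbelianSurfacesModular
import Literature.NumberTheory.DiophantineGeometry.BcgpSerreWreathReductionImprimitiveSurfaces
import Summits.Langlands.Langlands.Theorems.AbelianSurfaceSerreQuadraticImprimitiveSurfacesSerreWreathOfOrdinarySerre
import HarnessLib

/-!
# Crux `AbelianSurfaceSerre.QuadraticImprimitiveSurfaces` (stmt-Langlands-17766), line `Sketch`: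
# the crux below the two Targets, and its coarse conditional closure from Serre's conjecture for `GSp₄`

Three registered (non load-bearing) stubs of the skeleton `Lines/Sketch.lean` of the crux, in the
namespace of the line. All pure logic over the tree's declarations; the named facts enter ONLY as
explicit hypotheses of the registered signatures (`conditional-result`s, credited to nothing):

* `stub_ofEndTrivialSurfacesModular` — the crux is the route's Target `EndTrivialSurfacesModular`
  (stmt-Langlands-17764) restricted to the quadratically-imprimitive surfaces (drop a hypothesis);
* `stub_ofAbelianSurfacesModular` — it is also below the sibling Target
  `RegularSerreAbelianSurfaces.AbelianSurfacesModular` (stmt-Langlands-17568, body inlined), granted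
  Faltings' two theorems (tree named facts `faltings_tate_bijective`,
  `isSemisimpleRepresentation_rationalTateRep`, unproved), through the accepted irreducibility theorem
  `StableYoshidaCongruence.LevelThreeWeierstrassSwitch.stub_tateModuleIrreducible_of`
  (`End_ℚ(A) = ℤ` ⟹ the framed dual Tate module is irreducible);
* `stub_ofOrdinarySerre` — hence the crux follows from Serre's conjecture for `GSp₄/ℚ` in regular
  ordinary weight (`GL₄` proxy; body of `RegularSerreAbelianSurfaces.OrdinarySerreGSp4`,
  stmt-Langlands-17569, inlined) granted the printed BCGP 2025 Lemma 10.4.1 (accepted named fact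
  `bcgp_serreRegularWeight_implies_allAbelianSurfacesModular`) and Faltings. The line's load-bearing
  stubs sharpen the Serre input to the WREATH residues (named fact
  `bcgp_serreWreath_implies_quadraticImprimitiveSurfacesModular`, proposed separately); this file
  records the coarser closure that needs no new fact.

Two further theorems calibrate the line against the tree: `wreathReduction_iff_fact` — the
registered load-bearing stub `stub_wreathReduction` ("Serre at the wreath residues ⟹ the crux") is,
`Iff.rfl`, the accepted named fact `bcgp_serreWreath_implies_quadraticImprimitiveSurfacesModular`
(BCGP 2025 Lemma 10.4.1 along its proof p. 146, type **B**[C₂], + Thm. 10.2.1 + Faltings); and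
`QuadraticImprimitiveSurfaces_of_wreathFact` — the whole line in one theorem: the crux from that
fact and Serre's conjecture (body of `OrdinarySerreGSp4`), through the landed stub
`stub_serreWreath_of_ordinarySerre`.

This file imports the Theses file and is NOT to be imported by a module that closes an item of this
route by name.

References: Boxer–Calegari–Gee–Pilloni, arXiv:2502.20645, Lemma 10.4.1, Rem. 10.4.2 (proof p. 146),
Thm. 10.2.1, Rem. 10.2.2 [BoxerCalegariGeePilloni2025]; Faltings, Invent. Math. 73 (1983), Satz 3–4
[Faltings1983Endlichkeit].
-/

set_option linter.dupNamespace false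

namespace Summit.Langlands.Langlands.Cruxes.QuadraticImprimitiveSurfaces.Sketch

/-- **The crux is the Target restricted** (pure logic): `EndTrivialSurfacesModular` (every surface
with `End_ℚ(A) = ℤ` is modular, stmt-Langlands-17764) gives `QuadraticImprimitiveSurfaces` by
discarding the hypothesis "`r|Γ_K` reducible for some quadratic `K`". Registered as a (non
load-bearing) stub of line `Sketch` to record the crux's position below the Target. [folklore] -/
theorem stub_ofEndTrivialSurfacesModular
    (h : Summit.Langlands.Langlands.Theses.AbelianSurfaceSerre.EndTrivialSurfacesModular) :
    ∀ (A : Literature.AlgebraicGeometry.Motives.AbelianVariety ℚ), A.dim = 2 → (∀ f : A ⟶ A, ∃ n :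
    ℤ, f = n • CategoryTheory.CategoryStruct.id A) → ∀ (p : ℕ) [Fact p.Prime] (b : Module.Basis (Fin
    4) ℚ_[p] (A.rationalTateModule p)) (r :
    Literature.NumberTheory.GaloisRepresentations.FramedGaloisRep ℚ (PadicAlgCl p) 4), (∀ g :
    Field.absoluteGaloisGroup ℚ, (r g).val = ((LinearMap.toMatrix b b (A.rationalTateRep p g⁻¹)).map
    (algebraMap ℚ_[p] (PadicAlgCl p))).transpose) → (∃ (K : Type) (_ : Field K) (_ : NumberField K),
    Module.finrank ℚ K = 2 ∧ ¬ Literature.NumberTheory.GaloisRepresentations.FramedRep.IsIrreducible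
    (r.restrictField K)) → ∀ (hcpt :
    Literature.NumberTheory.Automorphic.isCompact_glFiniteIntegralLevel 4 ℚ) (ι : PadicAlgCl p ≃+*
    ℂ), ∃ π : Literature.NumberTheory.Automorphic.CuspidalAutomorphicRepData 4 ℚ hcpt,
    π.1.IsLAlgebraic ∧ ∀ᶠ v : IsDedekindDomain.HeightOneSpectrum (NumberField.RingOfIntegers ℚ) in
    Filter.cofinite, ∃ a : Multiset ℂ, π.1.HasSatakeParamAt v a ∧ r.IsUnramifiedAt v ∧
    r.HasFrobCharpolyAt v (Literature.NumberTheory.Automorphic.arithFrobPolyOfSatake ι v.residueCard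
    1 a) :=
  fun A hA hEnd p _ b r hr _ hcpt ι => h A hA hEnd p b r hr hcpt ι

/-- **The crux is below "all abelian surfaces with irreducible `H¹` are modular"** (the body of
`RegularSerreAbelianSurfaces.AbelianSurfacesModular`, stmt-Langlands-17568, inlined as `h`), GRANTED
Faltings' theorems for every `(B, p)` (tree named facts `faltings_tate_bijective` — Satz 4 /
Korollar 1 — and `isSemisimpleRepresentation_rationalTateRep` — Satz 3 —, unproved in the tree,
prepended as hypotheses): `End_ℚ(A) = ℤ` makes the framed dual Tate module `r` irreducible
(accepted `StableYoshidaCongruence.LevelThreeWeierstrassSwitch.stub_tateModuleIrreducible_of`: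
semisimple with scalar commutant, Burnside), so the irreducibility premise of the sibling Target is
met. [cite: Faltings1983Endlichkeit, §5 Satz 3–4] -/
theorem stub_ofAbelianSurfacesModular
    (hF : ∀ (p : ℕ) [Fact p.Prime] (B : Literature.AlgebraicGeometry.Motives.AbelianVariety ℚ),
      Literature.AlgebraicGeometry.Motives.faltings_tate_bijective B B p)
    (hS : ∀ (p : ℕ) [Fact p.Prime] (B : Literature.AlgebraicGeometry.Motives.AbelianVariety ℚ),
      Literature.AlgebraicGeometry.Motives.isSemisimpleRepresentation_rationalTateRep B p)
    (h : ∀ (A : Literature.AlgebraicGeometry.Motives.AbelianVariety ℚ), A.dim = 2 → ∀ (ℓ : ℕ) [Fact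
      ℓ.Prime] (b : Module.Basis (Fin 4) (Padic ℓ) (A.rationalTateModule ℓ)) (r :
      Literature.NumberTheory.GaloisRepresentations.FramedGaloisRep ℚ (PadicAlgCl ℓ) 4), (∀ g :
      Field.absoluteGaloisGroup ℚ, (r g).val = ((LinearMap.toMatrix b b (A.rationalTateRep ℓ
      g⁻¹)).map (algebraMap (Padic ℓ) (PadicAlgCl ℓ))).transpose) → r.toGaloisRep.IsIrreducible → ∀
      (hcpt : Literature.NumberTheory.Automorphic.isCompact_glFiniteIntegralLevel 4 ℚ) (ι :
      PadicAlgCl ℓ ≃+* ℂ), ∃ π : Literature.NumberTheory.Automorphic.CuspidalAutomorphicRepData 4 ℚ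
      hcpt, π.1.IsLAlgebraic ∧ ∀ᶠ v : IsDedekindDomain.HeightOneSpectrum (NumberField.RingOfIntegers
      ℚ) in Filter.cofinite, ∃ a : Multiset ℂ, π.1.HasSatakeParamAt v a ∧ r.IsUnramifiedAt v ∧
      r.HasFrobCharpolyAt v (Literature.NumberTheory.Automorphic.arithFrobPolyOfSatake ι
      v.residueCard 1 a)) :
    ∀ (A : Literature.AlgebraicGeometry.Motives.AbelianVariety ℚ), A.dim = 2 → (∀ f : A ⟶ A, ∃ n :
    ℤ, f = n • CategoryTheory.CategoryStruct.id A) → ∀ (p : ℕ) [Fact p.Prime] (b : Module.Basis (Fin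
    4) ℚ_[p] (A.rationalTateModule p)) (r :
    Literature.NumberTheory.GaloisRepresentations.FramedGaloisRep ℚ (PadicAlgCl p) 4), (∀ g :
    Field.absoluteGaloisGroup ℚ, (r g).val = ((LinearMap.toMatrix b b (A.rationalTateRep p g⁻¹)).map
    (algebraMap ℚ_[p] (PadicAlgCl p))).transpose) → (∃ (K : Type) (_ : Field K) (_ : NumberField K),
    Module.finrank ℚ K = 2 ∧ ¬ Literature.NumberTheory.GaloisRepresentations.FramedRep.IsIrreducible
    (r.restrictField K)) → ∀ (hcpt :
    Literature.NumberTheory.Automorphic.isCompact_glFiniteIntegralLevel 4 ℚ) (ι : PadicAlgCl p ≃+*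
    ℂ), ∃ π : Literature.NumberTheory.Automorphic.CuspidalAutomorphicRepData 4 ℚ hcpt,
    π.1.IsLAlgebraic ∧ ∀ᶠ v : IsDedekindDomain.HeightOneSpectrum (NumberField.RingOfIntegers ℚ) in
    Filter.cofinite, ∃ a : Multiset ℂ, π.1.HasSatakeParamAt v a ∧ r.IsUnramifiedAt v ∧
    r.HasFrobCharpolyAt v (Literature.NumberTheory.Automorphic.arithFrobPolyOfSatake ι v.residueCard
    1 a) := by
  intro A hA hEnd p _ b r hr _ hcpt ι
  exact h A hA p b r hr
    (Summit.Langlands.Langlands.Cruxes.StableYoshidaCongruence.LevelThreeWeierstrassSwitch.stub_tateModuleIrreducible_of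
      p A (hF p A) (hS p A) b r hr hEnd) hcpt ι

/-- **The crux from Serre's conjecture for `GSp₄/ℚ` in regular ordinary weight (`GL₄` proxy; the
body of `RegularSerreAbelianSurfaces.OrdinarySerreGSp4`, stmt-Langlands-17569, inlined as `hSerre`)**,
GRANTED the printed BCGP 2025 Lemma 10.4.1 with Rem. 10.4.2 and Thm. 10.2.1 (accepted named fact
`bcgp_serreRegularWeight_implies_allAbelianSurfacesModular`, unproved in the tree) and Faltings' two
theorems, all prepended as hypotheses: Serre makes every surface with irreducible `H¹` modular (the
fact) and `End_ℚ(A) = ℤ` makes `H¹` irreducible (Faltings). The COARSE conditional closure of the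
crux through existing names only; the load-bearing stubs of line `Sketch` sharpen the Serre input
to the wreath residues. [cite: BoxerCalegariGeePilloni2025, Lemma 10.4.1, Rem. 10.4.2, proof p. 146; Thm 10.2.1]
[cite: Faltings1983Endlichkeit, §5 Satz 3–4] -/
theorem stub_ofOrdinarySerre
    (hL : Literature.NumberTheory.DiophantineGeometry.bcgp_serreRegularWeight_implies_allAbelianSurfacesModular)
    (hF : ∀ (p : ℕ) [Fact p.Prime] (B : Literature.AlgebraicGeometry.Motives.AbelianVariety ℚ),
      Literature.AlgebraicGeometry.Motives.faltings_tate_bijective B B p)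
    (hS : ∀ (p : ℕ) [Fact p.Prime] (B : Literature.AlgebraicGeometry.Motives.AbelianVariety ℚ),
      Literature.AlgebraicGeometry.Motives.isSemisimpleRepresentation_rationalTateRep B p)
    (hSerre : ∃ P₀ : ℕ, ∀ (p : ℕ) [Fact p.Prime], P₀ ≤ p → ∀ (k : Type) [Field k] [CharP k p] [IsAlgClosed
      k] [TopologicalSpace k] [DiscreteTopology k] (red : Valued.integer (PadicAlgCl p) →+* k) (ρb :
      Literature.NumberTheory.GaloisRepresentations.FramedGaloisRep ℚ k 4),
      ρb.toGaloisRep.IsIrreducible → ρb.IsSymplecticWithMultiplierFun (fun g => (((Units.map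
      (ZMod.castHom (dvd_refl p) k).toMonoidHom ((modularCyclotomicCharacter (AlgebraicClosure ℚ)
      (HasEnoughRootsOfUnity.natCard_rootsOfUnity (AlgebraicClosure ℚ) p)).comp
      (MulSemiringAction.toRingAut (Field.absoluteGaloisGroup ℚ) (AlgebraicClosure ℚ)) g))⁻¹ : kˣ) :
      k)) → (∀ v : IsDedekindDomain.HeightOneSpectrum (NumberField.RingOfIntegers ℚ), ((p : ℕ) :
      NumberField.RingOfIntegers ℚ) ∈ v.asIdeal → ∃ g : Matrix.GeneralLinearGroup (Fin 4) k, ∀ (τ :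
      Field.absoluteGaloisGroup (v.adicCompletion ℚ)) (i j : Fin 4), j < i → (g * ρb.toLocal v τ *
      g⁻¹).val i j = 0) → ∀ (hcpt :
      Literature.NumberTheory.Automorphic.isCompact_glFiniteIntegralLevel 4 ℚ) (ι : PadicAlgCl p ≃+*
      ℂ), ∃ (π : Literature.NumberTheory.Automorphic.CuspidalAutomorphicRepData 4 ℚ hcpt) (r :
      Literature.NumberTheory.GaloisRepresentations.FramedGaloisRep ℚ (PadicAlgCl p) 4),
      π.1.IsRegularAlgebraic ∧ (∀ v : IsDedekindDomain.HeightOneSpectrum (NumberField.RingOfIntegers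
      ℚ), ((p : ℕ) : NumberField.RingOfIntegers ℚ) ∈ v.asIdeal → π.1.IsUnramifiedAt v) ∧ (∃ μ :
      Field.absoluteGaloisGroup ℚ → PadicAlgCl p, r.IsSymplecticWithMultiplierFun μ) ∧ (∀ v :
      IsDedekindDomain.HeightOneSpectrum (NumberField.RingOfIntegers ℚ), ((p : ℕ) :
      NumberField.RingOfIntegers ℚ) ∈ v.asIdeal → ∃ a : Fin 4 → ℕ, Function.Injective a ∧
      r.IsGreenbergOrdinaryOfShapeAt v a) ∧ (∀ᶠ v : IsDedekindDomain.HeightOneSpectrum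
      (NumberField.RingOfIntegers ℚ) in Filter.cofinite, ∃ α : Multiset ℂ, π.1.HasSatakeParamAt v α
      ∧ r.IsUnramifiedAt v ∧ r.HasFrobCharpolyAt v
      (Literature.NumberTheory.Automorphic.arithFrobPolyOfSatake ι v.residueCard 4 α)) ∧ (∀ᶠ v :
      IsDedekindDomain.HeightOneSpectrum (NumberField.RingOfIntegers ℚ) in Filter.cofinite,
      r.IsUnramifiedAt v ∧ ρb.IsUnramifiedAt v ∧ ∃ (P : Polynomial (Valued.integer (PadicAlgCl p)))
      (Pb : Polynomial k), r.HasFrobCharpolyAt v (P.map (Valued.integer (PadicAlgCl p)).subtype) ∧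
      ρb.HasFrobCharpolyAt v Pb ∧ P.map red = Pb)) :
    ∀ (A : Literature.AlgebraicGeometry.Motives.AbelianVariety ℚ), A.dim = 2 → (∀ f : A ⟶ A, ∃ n :
    ℤ, f = n • CategoryTheory.CategoryStruct.id A) → ∀ (p : ℕ) [Fact p.Prime] (b : Module.Basis (Fin
    4) ℚ_[p] (A.rationalTateModule p)) (r :
    Literature.NumberTheory.GaloisRepresentations.FramedGaloisRep ℚ (PadicAlgCl p) 4), (∀ g :
    Field.absoluteGaloisGroup ℚ, (r g).val = ((LinearMap.toMatrix b b (A.rationalTateRep p g⁻¹)).map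
    (algebraMap ℚ_[p] (PadicAlgCl p))).transpose) → (∃ (K : Type) (_ : Field K) (_ : NumberField K),
    Module.finrank ℚ K = 2 ∧ ¬ Literature.NumberTheory.GaloisRepresentations.FramedRep.IsIrreducible
    (r.restrictField K)) → ∀ (hcpt :
    Literature.NumberTheory.Automorphic.isCompact_glFiniteIntegralLevel 4 ℚ) (ι : PadicAlgCl p ≃+*
    ℂ), ∃ π : Literature.NumberTheory.Automorphic.CuspidalAutomorphicRepData 4 ℚ hcpt,
    π.1.IsLAlgebraic ∧ ∀ᶠ v : IsDedekindDomain.HeightOneSpectrum (NumberField.RingOfIntegers ℚ) in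
    Filter.cofinite, ∃ a : Multiset ℂ, π.1.HasSatakeParamAt v a ∧ r.IsUnramifiedAt v ∧
    r.HasFrobCharpolyAt v (Literature.NumberTheory.Automorphic.arithFrobPolyOfSatake ι v.residueCard
    1 a) :=
  stub_ofAbelianSurfacesModular hF hS (hL hSerre)

/-- **Calibration: the registered stub `stub_wreathReduction` IS the vended fact.** The
implication "Serre at the wreath residues ⟹ `QuadraticImprimitiveSurfaces`" (the load-bearing open
stub of line `Sketch`, antecedent written out) is definitionally the accepted named fact
`bcgp_serreWreath_implies_quadraticImprimitiveSurfacesModular` (its consequent is the body of the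
route decl): the fact neither loses nor gains strength against the stub.
[cite: BoxerCalegariGeePilloni2025, Lemma 10.4.1 proof p. 146 (type B[C₂]); Thm 10.2.1; Rem. 10.2.2] -/
theorem wreathReduction_iff_fact :
    ((∃ P₀ : ℕ, ∀ (p : ℕ) [Fact p.Prime], P₀ ≤ p → ∀ (k : Type) [Field k] [CharP k p] [IsAlgClosed
      k] [TopologicalSpace k] [DiscreteTopology k] (red : Valued.integer (PadicAlgCl p) →+* k) (ρb :
      Literature.NumberTheory.GaloisRepresentations.FramedGaloisRep ℚ k 4),
      ρb.toGaloisRep.IsIrreducible → ρb.IsSymplecticWithMultiplierFun (fun g => (((Units.map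
      (ZMod.castHom (dvd_refl p) k).toMonoidHom ((modularCyclotomicCharacter (AlgebraicClosure ℚ)
      (HasEnoughRootsOfUnity.natCard_rootsOfUnity (AlgebraicClosure ℚ) p)).comp
      (MulSemiringAction.toRingAut (Field.absoluteGaloisGroup ℚ) (AlgebraicClosure ℚ)) g))⁻¹ : kˣ) :
      k)) → (∀ v : IsDedekindDomain.HeightOneSpectrum (NumberField.RingOfIntegers ℚ), ((p : ℕ) :
      NumberField.RingOfIntegers ℚ) ∈ v.asIdeal → ∃ g : Matrix.GeneralLinearGroup (Fin 4) k, (∀ (τ :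
      Field.absoluteGaloisGroup (v.adicCompletion ℚ)) (i j : Fin 4), j < i → (g * ρb.toLocal v τ *
      g⁻¹).val i j = 0) ∧ ∀ i j : Fin 4, i ≠ j → ∃ τ : Field.absoluteGaloisGroup (v.adicCompletion
      ℚ), (g * ρb.toLocal v τ * g⁻¹).val i i ≠ (g * ρb.toLocal v τ * g⁻¹).val j j) → Nat.card
      ρb.toMonoidHom.range = 2 * p ^ 2 * (p - 1) * (p ^ 2 - 1) ^ 2 → (ρb.restrictField
      (CyclotomicField p ℚ)).toGaloisRep.IsIrreducible → (∃ (K : Type) (_ : Field K) (_ :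
      NumberField K), Module.finrank ℚ K = 2 ∧ ¬ (ρb.restrictField K).toGaloisRep.IsIrreducible) → ∀
      (hcpt : Literature.NumberTheory.Automorphic.isCompact_glFiniteIntegralLevel 4 ℚ) (ι :
      PadicAlgCl p ≃+* ℂ), ∃ (π : Literature.NumberTheory.Automorphic.CuspidalAutomorphicRepData 4 ℚ
      hcpt) (r : Literature.NumberTheory.GaloisRepresentations.FramedGaloisRep ℚ (PadicAlgCl p) 4),
      π.1.IsRegularAlgebraic ∧ (∀ v : IsDedekindDomain.HeightOneSpectrum (NumberField.RingOfIntegers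
      ℚ), ((p : ℕ) : NumberField.RingOfIntegers ℚ) ∈ v.asIdeal → π.1.IsUnramifiedAt v) ∧ (∃ μ :
      Field.absoluteGaloisGroup ℚ → PadicAlgCl p, r.IsSymplecticWithMultiplierFun μ) ∧ (∀ v :
      IsDedekindDomain.HeightOneSpectrum (NumberField.RingOfIntegers ℚ), ((p : ℕ) :
      NumberField.RingOfIntegers ℚ) ∈ v.asIdeal → ∃ a : Fin 4 → ℕ, Function.Injective a ∧
      r.IsGreenbergOrdinaryOfShapeAt v a) ∧ (∀ᶠ v : IsDedekindDomain.HeightOneSpectrum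
      (NumberField.RingOfIntegers ℚ) in Filter.cofinite, ∃ α : Multiset ℂ, π.1.HasSatakeParamAt v α
      ∧ r.IsUnramifiedAt v ∧ r.HasFrobCharpolyAt v
      (Literature.NumberTheory.Automorphic.arithFrobPolyOfSatake ι v.residueCard 4 α)) ∧ (∀ᶠ v :
      IsDedekindDomain.HeightOneSpectrum (NumberField.RingOfIntegers ℚ) in Filter.cofinite,
      r.IsUnramifiedAt v ∧ ρb.IsUnramifiedAt v ∧ ∃ (P : Polynomial (Valued.integer (PadicAlgCl p)))
      (Pb : Polynomial k), r.HasFrobCharpolyAt v (P.map (Valued.integer (PadicAlgCl p)).subtype) ∧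
      ρb.HasFrobCharpolyAt v Pb ∧ P.map red = Pb)) →
      Summit.Langlands.Langlands.Theses.AbelianSurfaceSerre.QuadraticImprimitiveSurfaces) ↔
    Literature.NumberTheory.DiophantineGeometry.bcgp_serreWreath_implies_quadraticImprimitiveSurfacesModular :=
  Iff.rfl

/-- **Line `Sketch` in one theorem (conditional closure by name).** GRANTED the printed reduction
(accepted named fact `bcgp_serreWreath_implies_quadraticImprimitiveSurfacesModular`: BCGP 2025
Lemma 10.4.1 along its proof p. 146 for Galois type **B**[C₂] + Thm. 10.2.1 + Faltings, unproved in
the tree), Serre's conjecture for `GSp₄/ℚ` in regular ordinary weight (`GL₄` proxy; the body of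
`RegularSerreAbelianSurfaces.OrdinarySerreGSp4`, stmt-Langlands-17569, as hypothesis `hSerre`)
gives the crux: restrict Serre to the wreath residues (landed stub
`stub_serreWreath_of_ordinarySerre`) and apply the fact. A `conditional-result`; the only inputs
missing for an unconditional proof are the open conjecture (indeed only its wreath restriction) and
a discharge of the printed fact.
[cite: BoxerCalegariGeePilloni2025, Lemma 10.4.1 proof p. 146 (type B[C₂]), Rem. 10.4.2; Thm 10.2.1] -/
theorem QuadraticImprimitiveSurfaces_of_wreathFact
    (hX : Literature.NumberTheory.DiophantineGeometry.bcgp_serreWreath_implies_quadraticImprimitiveSurfacesModular)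
    (hSerre : ∃ P₀ : ℕ, ∀ (p : ℕ) [Fact p.Prime], P₀ ≤ p → ∀ (k : Type) [Field k] [CharP k p] [IsAlgClosed
      k] [TopologicalSpace k] [DiscreteTopology k] (red : Valued.integer (PadicAlgCl p) →+* k) (ρb :
      Literature.NumberTheory.GaloisRepresentations.FramedGaloisRep ℚ k 4),
      ρb.toGaloisRep.IsIrreducible → ρb.IsSymplecticWithMultiplierFun (fun g => (((Units.map
      (ZMod.castHom (dvd_refl p) k).toMonoidHom ((modularCyclotomicCharacter (AlgebraicClosure ℚ)
      (HasEnoughRootsOfUnity.natCard_rootsOfUnity (AlgebraicClosure ℚ) p)).comp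
      (MulSemiringAction.toRingAut (Field.absoluteGaloisGroup ℚ) (AlgebraicClosure ℚ)) g))⁻¹ : kˣ) :
      k)) → (∀ v : IsDedekindDomain.HeightOneSpectrum (NumberField.RingOfIntegers ℚ), ((p : ℕ) :
      NumberField.RingOfIntegers ℚ) ∈ v.asIdeal → ∃ g : Matrix.GeneralLinearGroup (Fin 4) k, ∀ (τ :
      Field.absoluteGaloisGroup (v.adicCompletion ℚ)) (i j : Fin 4), j < i → (g * ρb.toLocal v τ *
      g⁻¹).val i j = 0) → ∀ (hcpt :
      Literature.NumberTheory.Automorphic.isCompact_glFiniteIntegralLevel 4 ℚ) (ι : PadicAlgCl p ≃+*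
      ℂ), ∃ (π : Literature.NumberTheory.Automorphic.CuspidalAutomorphicRepData 4 ℚ hcpt) (r :
      Literature.NumberTheory.GaloisRepresentations.FramedGaloisRep ℚ (PadicAlgCl p) 4),
      π.1.IsRegularAlgebraic ∧ (∀ v : IsDedekindDomain.HeightOneSpectrum (NumberField.RingOfIntegers
      ℚ), ((p : ℕ) : NumberField.RingOfIntegers ℚ) ∈ v.asIdeal → π.1.IsUnramifiedAt v) ∧ (∃ μ :
      Field.absoluteGaloisGroup ℚ → PadicAlgCl p, r.IsSymplecticWithMultiplierFun μ) ∧ (∀ v :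
      IsDedekindDomain.HeightOneSpectrum (NumberField.RingOfIntegers ℚ), ((p : ℕ) :
      NumberField.RingOfIntegers ℚ) ∈ v.asIdeal → ∃ a : Fin 4 → ℕ, Function.Injective a ∧
      r.IsGreenbergOrdinaryOfShapeAt v a) ∧ (∀ᶠ v : IsDedekindDomain.HeightOneSpectrum
      (NumberField.RingOfIntegers ℚ) in Filter.cofinite, ∃ α : Multiset ℂ, π.1.HasSatakeParamAt v α
      ∧ r.IsUnramifiedAt v ∧ r.HasFrobCharpolyAt v
      (Literature.NumberTheory.Automorphic.arithFrobPolyOfSatake ι v.residueCard 4 α)) ∧ (∀ᶠ v :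
      IsDedekindDomain.HeightOneSpectrum (NumberField.RingOfIntegers ℚ) in Filter.cofinite,
      r.IsUnramifiedAt v ∧ ρb.IsUnramifiedAt v ∧ ∃ (P : Polynomial (Valued.integer (PadicAlgCl p)))
      (Pb : Polynomial k), r.HasFrobCharpolyAt v (P.map (Valued.integer (PadicAlgCl p)).subtype) ∧
      ρb.HasFrobCharpolyAt v Pb ∧ P.map red = Pb)) :
    Summit.Langlands.Langlands.Theses.AbelianSurfaceSerre.QuadraticImprimitiveSurfaces :=
  hX (stub_serreWreath_of_ordinarySerre hSerre)

end Summit.Langlands.Langlands.Cruxes.QuadraticImprimitiveSurfaces.Sketch
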